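import Summits.QuantumFields.BalabanUV.Beta.GraphGreenFunction
import Summits.QuantumFields.BalabanUV.Beta.LatticeNewtonPotentialD4
import Summits.QuantumFields.BalabanUV.Beta.MeanValueBinderOfPoissonBound

/-!
# `Summit.QuantumFields.BalabanUV.Beta.HarmonicMeasureBoundD4` — THE HARMONIC-MEASURE BOUND (HMB) FOR THE MODEL IN d = 4, KERNEL:
# the Poisson kernel of the Euclidean lattice ball `C_n(x₀) = {⌊|· − x₀|⌋ < n}` of the unit torus `Π_{μ<4} ℤ/N_μ` (below half the period),
# seen from its centre, is `≤ 48/n³`; hence the row-D4 owner's mean-value binder `hMV` (file 16c) HOLDS for d = 4 with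
# `C_MV = max(1, 6⁴·48)` — O.2 item (ii-b) for the MODEL with constant weights, Bałaban's dimension, WITHOUT HYPOTHESIS OR LEAF

HONEST FRAMING (page 1 of everything in this cell).  Discharging `FlowStep.BetaPertH` would make Bałaban's ultraviolet
stability UNCONDITIONAL — a constructive-QFT result; it is NOT the continuum limit and NOT the Clay problem.  This module
discharges nothing of `BetaPertH`; it is [folklore] discrete potential theory for the FREE Laplacian of the torus MODEL, kernel-checked,
by CO-OWNER #3 of binder row D4 (unit `b2b-balaban-beta-d4-p3`, road P3 «reduction road», gen 12).  HONEST DEPENDENCY: continuum YM on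
T⁴ ⇐ BetaPertH ∧ nine spine estimates (0/9 proved); BetaPertH ⇐ (D1) ∧ (D4) ∧ CAP+tail; G-an2-4 gates asym, D1 and NE2/3/4.

THE POINT.  Road P3 reduced O.2 item (ii-b) for the MODEL to ONE pointwise bound (HMB) on the Poisson kernel of a lattice ball from its
centre (`MeanValueBinderOfPoissonBound.hMV_of_poisson_bound`).  THIS FILE PROVES (HMB) for `d = 4` by the classical comparison
argument, with every ingredient in the kernel: the lattice-superharmonic Newton potential `ψ = 1/(|· − x₀|² + 3)` with defect `2/3` at
the centre (`LatticeNewtonPotentialD4`), the Dirichlet Green's function with comparison, last exit and symmetry (`GraphGreenFunction`),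
and the box unit supersolution of the owner's file 15b:
* §1 `newton_unit_supersolution` — `W·ψ ≥ Nψ` for the unit weight below half the period, `= Nψ + 2/3` at `x₀` (bond sums of 15b);
* §2 the comparison function `w = (3/2)·(ψ − 1/((n+1)²+3))⁺`: nonnegative, equal to `(3/2)(ψ − L)` wherever `⌊|· − x₀|⌋ ≤ n`, and a
  supersolution with source `≥ δ_{x₀}` on `C_n(x₀)`; hence **`green_ball_le`**: `green (C_n(x₀)) z x₀ ≤ w z`;
* §3 **`poisson_centre_le_d4`** — (HMB): for `n ≥ 1`, `2n + 2 ≤ N_μ`, `⌊|y − x₀|⌋ = n`: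
  `poisson₁ (C_n(x₀)) x₀ y ≤ 48·n/(((n−1)²+3)((n+1)²+3)) ≤ 48/n³` (last exit from the pole `x₀`: only the `≤ 8` bonds into `y` count,
  each from a `z` with `⌊|z − x₀|⌋ ≥ n − 1`, where `w ≤ (3/2)(1/((n−1)²+3) − 1/((n+1)²+3)) = 6n/(n⁴ + 4n² + 16)`);
* §4 **`hMV_d4`** — the OWNER'S BINDER `hMV` of `MultiscaleRegularityOfMeanValue` for every torus `Π_{μ<4} ℤ/N_μ`, with
  `C_MV = max(1, 6⁴·48)`, NO hypothesis (`hMV_of_poisson_bound` at `K₀ = 48`).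
So after this file, for the MODEL with constant weights in d = 4, file 9b's `hreg` and the sup member (3.42)₁'s SHAPE hold
OUTRIGHT (16c's `real_sup_levelOp_inverse_le_of_meanValue` ∘ `hMV_d4`; `MultiscaleRegularityD4`).  STATUS IN THE ROW: co-owner beta-d4-p2's
`SubsolutionMeanValueL1.hMV_holds` (De Giorgi iteration, GENERAL d, side condition `10r + 4 ≤ N_μ`) is the PRIMARY kernel route to the
owner's binder (owner's ruling R-an4-45-1); THIS file is the SECOND, TECHNIQUE-DISTINCT kernel engine for d = 4 (explicit Newton
potential, side condition `2r + 2 ≤ N_μ`, explicit constant) — an independent cross-check, not a competing claim.  Numerically the sharp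
constant is `K₀ ≈ 0.14` (kit job j109519); `48` is the price of the explicit comparison — level-free, which is all that matters.  General
`d` along these lines would use `ψ = (|x|² + a_d)^{−(d−2)/2}`.

LOCATORS (shape only, nothing printed asserted; ABSOLUTE RULE): [Balaban1985BackgroundPropagators] Thm 3.1 (3.42) p. 397;
[Balaban1984PropagatorsII] Prop. 2.2 (2.67) p. 234.  Row D4: NO class change for Bałaban (critical-path width 0; D4 DISCHARGE NO DATE);
NOT BetaPertH, NOT continuum, NOT Clay, NOT summit progress.
-/

open scoped BigOperators
open Finset

namespace Summit.QuantumFields.BalabanUV.Beta.HarmonicMeasureBoundD4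

open Literature.MathematicalPhysics.QuantumFieldTheory.Balaban1983to89
open Literature.MathematicalPhysics.QuantumFieldTheory.Balaban1983to89.B9Thm37GluePU (bsrc btgt bsrc_apply btgt_apply
  card_src_star card_tgt_star)
open B4Sect5Torus (ccoord)
open B5TorusCover (UT)
open B5Leibniz121 (up dn)
open Summit.QuantumFields.BalabanUV.Beta.TorusBoxSupersolution (sum_tgt_const sum_src_const wsum_tgt_const wsum_src_const
  exists_unit_supersolution_box)
open Summit.QuantumFields.BalabanUV.Beta.GraphPoissonKernel (poisson)
open Summit.QuantumFields.BalabanUV.Beta.GraphGreenFunction (green green_le_of_supersolution poisson_eq_sum_green_pole)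
open Summit.QuantumFields.BalabanUV.Beta.TorusBallMeanValue (sqRad erad erad_self ccoord_le_erad erad_lipschitz dist_le_of_erad_le)
open Summit.QuantumFields.BalabanUV.Beta.LatticeNewtonPotentialD4 (newton_superharmonic_d4 newton_sum_centre_d4 newton_centre_d4)
open Summit.QuantumFields.BalabanUV.Beta.MeanValueBinderOfPoissonBound (hMV_of_poisson_bound)

noncomputable section

variable {N : Fin 4 → ℕ} [∀ i, NeZero (N i)]

/-! ## §1 `ψ` as a unit-weight supersolution below half the period -/

omit [∀ i, NeZero (N i)] in
/-- Below half the period around `x₀` (`⌊|x − x₀|⌋ ≤ n`, `2n + 2 ≤ N_μ`) every coordinate step stays below half the period: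
`2(δ_μ(x,x₀) + 1) ≤ N_μ`. [folklore] -/
theorem nowrap_of_erad_le (x₀ x : UT N) {n : ℕ} (hr : ∀ μ, 2 * n + 2 ≤ N μ) (hx : erad x₀ x ≤ n) (μ : Fin 4) :
    2 * ((ccoord N (UT.toSite N x) (UT.toSite N x₀) μ : ℕ) + 1) ≤ N μ := by
  have h1 := ccoord_le_erad x₀ x μ
  have h2 := hr μ
  omega

/-- **`W·ψ − Nψ ≥ 0` for the unit weight** at every `x` with `⌊|x − x₀|⌋ ≤ n`, `2n+2 ≤ N_μ` (file 15b's bond sums +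
`newton_superharmonic_d4`). [folklore] -/
theorem newton_unit_supersolution (x₀ : UT N) (ψ : UT N → ℝ) (hψ : ∀ y, ψ y = 1 / ((sqRad x₀ y : ℝ) + 3)) {n : ℕ}
    (hr : ∀ μ, 2 * n + 2 ≤ N μ) (x : UT N) (hx : erad x₀ x ≤ n) :
    ((∑ b ∈ univ.filter (fun b : UT N × Fin 4 => btgt b = x), (fun _ : UT N × Fin 4 => (1 : ℝ)) b ^ 2 * ψ (bsrc b)) +
        ∑ b ∈ univ.filter (fun b : UT N × Fin 4 => bsrc b = x), (fun _ : UT N × Fin 4 => (1 : ℝ)) b ^ 2 * ψ (btgt b)) ≤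
      ((∑ b ∈ univ.filter (fun b : UT N × Fin 4 => btgt b = x), (fun _ : UT N × Fin 4 => (1 : ℝ)) b ^ 2) +
        ∑ b ∈ univ.filter (fun b : UT N × Fin 4 => bsrc b = x), (fun _ : UT N × Fin 4 => (1 : ℝ)) b ^ 2) * ψ x := by
  have hcc : ∀ b : UT N × Fin 4, (fun _ : UT N × Fin 4 => (1 : ℝ)) b = 1 := fun _ => rfl
  rw [sum_tgt_const hcc, sum_src_const hcc, wsum_tgt_const hcc, wsum_src_const hcc]
  have h := newton_superharmonic_d4 x₀ ψ hψ x (nowrap_of_erad_le x₀ x hr hx)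
  rw [Finset.sum_add_distrib] at h
  norm_num
  linarith

/-! ## §2 The comparison function and the bound on the Green's function of the ball -/

omit [∀ i, NeZero (N i)] in
/-- `⌊|z − x₀|⌋ ≤ n ⟹ ψ(z) > 1/((n+1)² + 3)` (`sqRad z < (n+1)²`). [folklore] -/
theorem psi_gt_level (x₀ : UT N) (ψ : UT N → ℝ) (hψ : ∀ y, ψ y = 1 / ((sqRad x₀ y : ℝ) + 3)) {n : ℕ} (z : UT N)
    (hz : erad x₀ z ≤ n) : 1 / (((n : ℝ) + 1) ^ 2 + 3) < ψ z := by
  have h1 : sqRad x₀ z < (n + 1) ^ 2 := Nat.sqrt_lt'.mp (Nat.lt_succ_of_le hz)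
  have h2 : (sqRad x₀ z : ℝ) + 3 < ((n : ℝ) + 1) ^ 2 + 3 := by
    have : (sqRad x₀ z : ℝ) < ((n : ℝ) + 1) ^ 2 := by exact_mod_cast h1
    linarith
  rw [hψ]
  exact one_div_lt_one_div_of_lt (by positivity) h2

omit [∀ i, NeZero (N i)] in
/-- `⌊|z − x₀|⌋ ≥ n − 1 ⟹ ψ(z) ≤ 1/((n−1)² + 3)` (`sqRad z ≥ (n−1)²`). [folklore] -/
theorem psi_le_of_erad_ge (x₀ : UT N) (ψ : UT N → ℝ) (hψ : ∀ y, ψ y = 1 / ((sqRad x₀ y : ℝ) + 3)) {n : ℕ} (z : UT N)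
    (hz : n - 1 ≤ erad x₀ z) : ψ z ≤ 1 / (((n : ℝ) - 1) ^ 2 + 3) ∨ n = 0 := by
  rcases Nat.eq_zero_or_pos n with hn | hn
  · exact Or.inr hn
  · left
    have h1 : (n - 1) ^ 2 ≤ sqRad x₀ z := Nat.le_sqrt'.mp hz
    have h2 : (((n : ℝ) - 1)) ^ 2 + 3 ≤ (sqRad x₀ z : ℝ) + 3 := by
      have h3 : (((n - 1 : ℕ) : ℝ)) ^ 2 ≤ (sqRad x₀ z : ℝ) := by exact_mod_cast h1
      have h4 : ((n - 1 : ℕ) : ℝ) = (n : ℝ) - 1 := by rw [Nat.cast_sub hn]; simp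
      rw [h4] at h3; linarith
    rw [hψ]
    exact one_div_le_one_div_of_le (by positivity) h2

/-- **THE GREEN'S FUNCTION OF THE BALL FROM ITS CENTRE IS DOMINATED BY THE SHIFTED NEWTON POTENTIAL**: for `2n+2 ≤ N_μ`,
`C_n(x₀) = {⌊|· − x₀|⌋ < n}` and the unit weight, `green (C_n(x₀)) z x₀ ≤ (3/2)·max(ψ(z) − 1/((n+1)²+3), 0)` for every `z`
(`GraphGreenFunction.green_le_of_supersolution`: the right side is `≥ 0`, equals `(3/2)(ψ − L)` on the ball and its neighbours, where
`W·(ψ − L) − N(ψ − L) = W·ψ − Nψ ≥ 0` (§1), and `= (3/2)·(2/3) = 1` at `x₀`). [folklore] -/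
theorem green_ball_le (x₀ : UT N) (ψ : UT N → ℝ) (hψ : ∀ y, ψ y = 1 / ((sqRad x₀ y : ℝ) + 3)) {n : ℕ}
    (hr : ∀ μ, 2 * n + 2 ≤ N μ) (z : UT N) :
    green bsrc btgt (fun _ : UT N × Fin 4 => (1 : ℝ)) (univ.filter (fun y => erad x₀ y < n)) z x₀ ≤
      3 / 2 * max (ψ z - 1 / (((n : ℝ) + 1) ^ 2 + 3)) 0 := by
  classical
  set L : ℝ := 1 / (((n : ℝ) + 1) ^ 2 + 3) with hL
  set B := univ.filter (fun y : UT N => erad x₀ y < n) with hB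
  set w : UT N → ℝ := fun z => 3 / 2 * max (ψ z - L) 0 with hw
  -- the box unit supersolution, restricted to the ball
  obtain ⟨w₀, hw₀0, -, hw₀⟩ := exists_unit_supersolution_box (c := fun _ : UT N × Fin 4 => (1 : ℝ)) (c₀ := 1)
    (fun _ => rfl) one_ne_zero x₀ hr
  have hsub : ∀ x ∈ B, x ∈ univ.filter (fun x : UT N => dist x x₀ ≤ n) :=
    fun x hx => mem_filter.mpr ⟨mem_univ _, dist_le_of_erad_le x₀ x (mem_filter.mp hx).2.le⟩
  -- `w = (3/2)(ψ − L)` wherever `erad ≤ n`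
  have hweq : ∀ y : UT N, erad x₀ y ≤ n → w y = 3 / 2 * (ψ y - L) := by
    intro y hy
    have := psi_gt_level x₀ ψ hψ y hy
    simp only [hw, max_eq_left (by linarith : (0 : ℝ) ≤ ψ y - L)]
  refine green_le_of_supersolution bsrc btgt _ B w₀ hw₀0 (fun x hx => hw₀ x (hsub x hx)) x₀ w
    (fun x _ => by positivity) (fun x hx => ?_) z
  -- the supersolution inequality on the ball
  have hxn : erad x₀ x < n := (mem_filter.mp hx).2
  have hcc : ∀ b : UT N × Fin 4, (fun _ : UT N × Fin 4 => (1 : ℝ)) b = 1 := fun _ => rfl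
  rw [sum_tgt_const hcc, sum_src_const hcc, wsum_tgt_const hcc, wsum_src_const hcc]
  -- neighbours have `erad ≤ n`, so `w` is affine in `ψ` there
  have hup : ∀ μ, w (up x μ) = 3 / 2 * (ψ (up x μ) - L) := fun μ =>
    hweq _ (by have := (erad_lipschitz x₀ (x, μ)).1; rw [btgt_apply, bsrc_apply] at this; omega)
  have hdn : ∀ μ, w (dn x μ) = 3 / 2 * (ψ (dn x μ) - L) := fun μ => by
    refine hweq _ ?_
    have h := (erad_lipschitz x₀ (dn x μ, μ)).2
    rw [btgt_apply, bsrc_apply, B5Leibniz121.up_dn] at h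
    omega
  have hwx : w x = 3 / 2 * (ψ x - L) := hweq x hxn.le
  -- package the neighbour sums
  have hNsum : ∑ μ, w (dn x μ) + ∑ μ, w (up x μ) = 3 / 2 * (∑ μ, ψ (up x μ) + ∑ μ, ψ (dn x μ)) - 12 * L := by
    simp only [hup, hdn, mul_sub, Finset.sum_sub_distrib, ← Finset.mul_sum, Finset.sum_const, Finset.card_univ, Fintype.card_fin,
      nsmul_eq_mul]
    push_cast
    ring
  have hsh := newton_superharmonic_d4 x₀ ψ hψ x (nowrap_of_erad_le x₀ x hr hxn.le)
  rw [Finset.sum_add_distrib] at hsh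
  rw [hwx]
  have hgoal : ((4 : ℕ) * (1 : ℝ) ^ 2 + (4 : ℕ) * (1 : ℝ) ^ 2) * (3 / 2 * (ψ x - L)) -
      ((1 : ℝ) ^ 2 * ∑ μ, w (dn x μ) + (1 : ℝ) ^ 2 * ∑ μ, w (up x μ)) = 12 * ψ x - 3 / 2 * (∑ μ, ψ (up x μ) + ∑ μ, ψ (dn x μ)) := by
    rw [one_pow, one_mul, one_mul, hNsum]; push_cast; ring
  rw [hgoal]
  by_cases hx0 : x = x₀
  · subst hx0
    rw [if_pos rfl]
    have hc := newton_sum_centre_d4 x ψ hψ (fun μ => by have := hr μ; omega)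
    rw [Finset.sum_add_distrib] at hc
    have hψ0 := newton_centre_d4 x ψ hψ
    rw [hc, hψ0]; norm_num
  · rw [if_neg hx0]
    linarith

/-! ## §3 (HMB) for d = 4 -/

/-- If a bond of the torus joins `z` to `y` then their integer radii differ by at most one. [folklore] -/
theorem erad_ge_of_adj (x₀ z y : UT N) (b : UT N × Fin 4)
    (hb : (btgt b = z ∧ bsrc b = y) ∨ (bsrc b = z ∧ btgt b = y)) : erad x₀ y ≤ erad x₀ z + 1 := by
  have h := erad_lipschitz x₀ b
  rcases hb with ⟨h1, h2⟩ | ⟨h1, h2⟩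
  · rw [h1, h2] at h; exact h.2
  · rw [h1, h2] at h; exact h.1

/-- **THE HARMONIC-MEASURE BOUND (HMB) IN d = 4, KERNEL.**  On the unit torus `Π_{μ<4} ℤ/N_μ` with unit bond weights, for every
centre `x₀`, every `n ≥ 1` with `2n + 2 ≤ N_μ` for all `μ`, and every `y` with `⌊|y − x₀|⌋ = n`:
`poisson₁ (C_n(x₀)) x₀ y ≤ 48/n³`, `C_n(x₀) = {⌊|· − x₀|⌋ < n}`.  Proof: last exit from the pole `x₀`
(`GraphGreenFunction.poisson_eq_sum_green_pole`), the Green bound of §2 at the `≤ 8` bonds into `y` — each from a `z` with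
`⌊|z − x₀|⌋ ≥ n − 1`, where `(3/2)(ψ(z) − L) ≤ (3/2)(1/((n−1)²+3) − 1/((n+1)²+3)) = 6n/(n⁴ + 4n² + 16)` — and
`48n/(n⁴ + 4n² + 16) ≤ 48/n³`.  This is Lawler–Limic's Lemma 6.3.7 (upper half, at the centre, simple random walk) for d = 4
with an explicit constant, proved rather than cited. [folklore] -/
theorem poisson_centre_le_d4 (x₀ : UT N) (n : ℕ) (hn : 1 ≤ n) (hr : ∀ μ, 2 * n + 2 ≤ N μ) (y : UT N) (hy : erad x₀ y = n) :
    poisson bsrc btgt (fun _ : UT N × Fin 4 => (1 : ℝ)) (univ.filter (fun y => erad x₀ y < n)) x₀ y ≤ 48 / (n : ℝ) ^ 3 := by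
  classical
  set ψ : UT N → ℝ := fun y => 1 / ((sqRad x₀ y : ℝ) + 3) with hψdef
  have hψ : ∀ y, ψ y = 1 / ((sqRad x₀ y : ℝ) + 3) := fun _ => rfl
  set L : ℝ := 1 / (((n : ℝ) + 1) ^ 2 + 3) with hL
  set β : ℝ := 3 / 2 * (1 / (((n : ℝ) - 1) ^ 2 + 3) - L) with hβ
  set B := univ.filter (fun y : UT N => erad x₀ y < n) with hB
  obtain ⟨w₀, hw₀0, -, hw₀⟩ := exists_unit_supersolution_box (c := fun _ : UT N × Fin 4 => (1 : ℝ)) (c₀ := 1)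
    (fun _ => rfl) one_ne_zero x₀ hr
  have hsub : ∀ x ∈ B, x ∈ univ.filter (fun x : UT N => dist x x₀ ≤ n) :=
    fun x hx => mem_filter.mpr ⟨mem_univ _, dist_le_of_erad_le x₀ x (mem_filter.mp hx).2.le⟩
  have hx₀ : x₀ ∈ B := mem_filter.mpr ⟨mem_univ _, by rw [erad_self]; omega⟩
  have hyB : y ∉ B := fun h => by have := (mem_filter.mp h).2; omega
  rw [poisson_eq_sum_green_pole bsrc btgt _ B w₀ hw₀0 (fun x hx => hw₀ x (hsub x hx)) x₀ y hx₀ hyB]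
  -- termwise: `green z x₀ · (Nδ_y)(z) ≤ β · (Nδ_y)(z)`
  have hnn : ∀ z : UT N, 0 ≤ (∑ b ∈ univ.filter (fun b : UT N × Fin 4 => btgt b = z),
      (fun _ : UT N × Fin 4 => (1 : ℝ)) b ^ 2 * (if bsrc b = y then (1 : ℝ) else 0)) +
      ∑ b ∈ univ.filter (fun b : UT N × Fin 4 => bsrc b = z), (fun _ : UT N × Fin 4 => (1 : ℝ)) b ^ 2 *
        (if btgt b = y then (1 : ℝ) else 0) := fun z => by positivity
  have hterm : ∀ z ∈ B, green bsrc btgt (fun _ : UT N × Fin 4 => (1 : ℝ)) B z x₀ *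
      ((∑ b ∈ univ.filter (fun b : UT N × Fin 4 => btgt b = z), (fun _ : UT N × Fin 4 => (1 : ℝ)) b ^ 2 *
          (if bsrc b = y then (1 : ℝ) else 0)) +
        ∑ b ∈ univ.filter (fun b : UT N × Fin 4 => bsrc b = z), (fun _ : UT N × Fin 4 => (1 : ℝ)) b ^ 2 *
          (if btgt b = y then (1 : ℝ) else 0)) ≤
      β * ((∑ b ∈ univ.filter (fun b : UT N × Fin 4 => btgt b = z), (fun _ : UT N × Fin 4 => (1 : ℝ)) b ^ 2 *
          (if bsrc b = y then (1 : ℝ) else 0)) +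
        ∑ b ∈ univ.filter (fun b : UT N × Fin 4 => bsrc b = z), (fun _ : UT N × Fin 4 => (1 : ℝ)) b ^ 2 *
          (if btgt b = y then (1 : ℝ) else 0)) := by
    intro z hz
    by_cases hadj : ∃ b : UT N × Fin 4, (btgt b = z ∧ bsrc b = y) ∨ (bsrc b = z ∧ btgt b = y)
    · -- `z` is adjacent to `y`: `erad z ≥ n − 1`, so `green ≤ w z = (3/2)(ψ z − L) ≤ β`
      obtain ⟨b, hb⟩ := hadj
      have hzn : n - 1 ≤ erad x₀ z := by have := erad_ge_of_adj x₀ z y b hb; omega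
      have hg := green_ball_le x₀ ψ hψ hr z
      have hzle : erad x₀ z ≤ n := (mem_filter.mp hz).2.le
      have hpos := psi_gt_level x₀ ψ hψ z hzle
      rw [max_eq_left (sub_nonneg.mpr hpos.le)] at hg
      rcases psi_le_of_erad_ge x₀ ψ hψ z hzn with hψz | h0
      · refine mul_le_mul_of_nonneg_right (hg.trans ?_) (hnn z)
        rw [hβ, hL]; linarith
      · omega
    · -- no bond joins `z` to `y`: the bond weight sum vanishes
      push Not at hadj
      have hzero : (∑ b ∈ univ.filter (fun b : UT N × Fin 4 => btgt b = z), (fun _ : UT N × Fin 4 => (1 : ℝ)) b ^ 2 *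
            (if bsrc b = y then (1 : ℝ) else 0)) +
          ∑ b ∈ univ.filter (fun b : UT N × Fin 4 => bsrc b = z), (fun _ : UT N × Fin 4 => (1 : ℝ)) b ^ 2 *
            (if btgt b = y then (1 : ℝ) else 0) = 0 := by
        rw [Finset.sum_eq_zero, Finset.sum_eq_zero, add_zero]
        · intro b hb
          rw [if_neg ((hadj b).2 (mem_filter.mp hb).2), mul_zero]
        · intro b hb
          rw [if_neg ((hadj b).1 (mem_filter.mp hb).2), mul_zero]
      rw [hzero, mul_zero, mul_zero]
  refine (Finset.sum_le_sum hterm).trans ?_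
  rw [← Finset.mul_sum]
  -- total bond weight into `y` is `8`
  have htot : ∑ z ∈ B, ((∑ b ∈ univ.filter (fun b : UT N × Fin 4 => btgt b = z), (fun _ : UT N × Fin 4 => (1 : ℝ)) b ^ 2 *
        (if bsrc b = y then (1 : ℝ) else 0)) +
      ∑ b ∈ univ.filter (fun b : UT N × Fin 4 => bsrc b = z), (fun _ : UT N × Fin 4 => (1 : ℝ)) b ^ 2 *
        (if btgt b = y then (1 : ℝ) else 0)) ≤ 8 := by
    calc _ ≤ ∑ z : UT N, ((∑ b ∈ univ.filter (fun b : UT N × Fin 4 => btgt b = z), (fun _ : UT N × Fin 4 => (1 : ℝ)) b ^ 2 *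
            (if bsrc b = y then (1 : ℝ) else 0)) +
          ∑ b ∈ univ.filter (fun b : UT N × Fin 4 => bsrc b = z), (fun _ : UT N × Fin 4 => (1 : ℝ)) b ^ 2 *
            (if btgt b = y then (1 : ℝ) else 0)) :=
          Finset.sum_le_sum_of_subset_of_nonneg (Finset.filter_subset _ _) (fun z _ _ => hnn z)
      _ = (∑ b : UT N × Fin 4, (if bsrc b = y then (1 : ℝ) else 0)) + ∑ b : UT N × Fin 4, (if btgt b = y then (1 : ℝ) else 0) := by
          rw [Finset.sum_add_distrib]
          congr 1
          · rw [← Finset.sum_fiberwise_of_maps_to (s := (univ : Finset (UT N × Fin 4))) (t := (univ : Finset (UT N)))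
              (g := btgt) (fun _ _ => mem_univ _)]
            exact Finset.sum_congr rfl fun z _ => Finset.sum_congr rfl fun b _ => by simp
          · rw [← Finset.sum_fiberwise_of_maps_to (s := (univ : Finset (UT N × Fin 4))) (t := (univ : Finset (UT N)))
              (g := bsrc) (fun _ _ => mem_univ _)]
            exact Finset.sum_congr rfl fun z _ => Finset.sum_congr rfl fun b _ => by simp
      _ = 8 := by
          rw [Finset.sum_boole, Finset.sum_boole, card_src_star, card_tgt_star]
          norm_num
  have hβ0 : 0 ≤ β := by
    rw [hβ, hL]
    have : 1 / (((n : ℝ) + 1) ^ 2 + 3) ≤ 1 / (((n : ℝ) - 1) ^ 2 + 3) :=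
      one_div_le_one_div_of_le (by positivity) (by nlinarith [(Nat.cast_nonneg n : (0 : ℝ) ≤ n)])
    linarith
  calc β * _ ≤ β * 8 := mul_le_mul_of_nonneg_left htot hβ0
    _ ≤ 48 / (n : ℝ) ^ 3 := by
        -- `8β = 48n/(((n−1)²+3)((n+1)²+3))` and `((n−1)²+3)((n+1)²+3) = n⁴ + 4n² + 16 ≥ n⁴`
        have hn' : (1 : ℝ) ≤ n := by exact_mod_cast hn
        have hnpos : (0 : ℝ) < n := by linarith
        have e : β * 8 = 48 * n / ((((n : ℝ) - 1) ^ 2 + 3) * (((n : ℝ) + 1) ^ 2 + 3)) := by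
          rw [hβ, hL]
          field_simp
          ring
        rw [e, div_le_div_iff₀ (by positivity) (by positivity)]
        have h4 : (((n : ℝ) - 1) ^ 2 + 3) * (((n : ℝ) + 1) ^ 2 + 3) = (n : ℝ) ^ 4 + 4 * n ^ 2 + 16 := by ring
        rw [h4]
        nlinarith [pow_pos hnpos 3, pow_pos hnpos 5, sq_nonneg (n : ℝ)]

/-- (HMB) in the exact hypothesis shape of `MeanValueBinderOfPoissonBound.hMV_of_poisson_bound` (`K₀ = 48`, exponent `d − 1 = 3`).
[folklore] -/
theorem poisson_centre_le_d4' :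
    ∀ (x₀ : UT N) (n : ℕ), 1 ≤ n → (∀ μ, 2 * n + 2 ≤ N μ) → ∀ y : UT N, erad x₀ y = n →
      poisson bsrc btgt (fun _ : UT N × Fin 4 => (1 : ℝ)) (univ.filter (fun y => erad x₀ y < n)) x₀ y ≤
        48 / (n : ℝ) ^ (4 - 1) :=
  fun x₀ n hn hr y hy => by simpa using poisson_centre_le_d4 x₀ n hn hr y hy

/-! ## §4 THE OWNER'S MEAN-VALUE BINDER FOR d = 4, HYPOTHESIS-FREE -/

/-- **THE MEAN-VALUE BINDER `hMV` OF FILE 16c HOLDS IN d = 4** (unit torus `Π_{μ<4} ℤ/N_μ`), with `C_MV = max(1, 6⁴·48)`: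
for every centre `x₀`, radius `r` with `2r + 2 ≤ N_μ`, and `z ≥ 0` with `2·4·z(x) ≤ Σ_μ (z(x+e_μ) + z(x−e_μ))` whenever
`dist(x,x₀) ≤ r`: `z(x₀) ≤ C_MV/(2r+1)⁴ · Σ_{dist(x,x₀) ≤ r} z(x)`.  NO hypothesis: (HMB) is `poisson_centre_le_d4'`.
So `MultiscaleRegularityOfMeanValue.hreg_of_meanValue` ∕ `real_sup_levelOp_inverse_le_of_meanValue` apply OUTRIGHT for the MODEL
with constant weights in Bałaban's dimension. [cite: Balaban1985BackgroundPropagators, Thm 3.1 (3.42) p.397] [folklore] -/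
theorem hMV_d4 :
    ∀ (x₀ : UT N) (r : ℕ), (∀ μ, 2 * r + 2 ≤ N μ) → ∀ z : UT N → ℝ, (∀ y, 0 ≤ z y) →
      (∀ x, dist x x₀ ≤ r → 2 * (4 : ℕ) * z x ≤ ∑ μ, (z (up x μ) + z (dn x μ))) →
      z x₀ ≤ max 1 (6 ^ (4 : ℕ) * 48) / (2 * r + 1 : ℝ) ^ (4 : ℕ) * ∑ x ∈ univ.filter (fun x : UT N => dist x x₀ ≤ r), z x :=
  hMV_of_poisson_bound (d := 4) (by norm_num) poisson_centre_le_d4'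

end

end Summit.QuantumFields.BalabanUV.Beta.HarmonicMeasureBoundD4
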